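import Literature.NumberTheory.LFunctions.YoshidaWindowGramColumnData
import HarnessLib

/-!
# C∞ rung `R1E` (even sector) — DATA `L2T` part 1/1

Route context: Fourier–Galerkin / Schur-complement certificates of Weil positivity on a window ("format C", C∞ door `weilPositivityOn_of_cinf_pipeline`); supporting stmt-RiemannHypothesis-0098; seat rh-explicit-weil-2 (`cinfemit.py`/`emit_lean2.py`, HOME/rh-explicit-weil-2/gen17/EMITTER-PHASE2.md). Data / bookkeeping only; standard axioms; no RH claim.
-/

set_option autoImplicit false
-- `Summit.RiemannHypothesis.RiemannHypothesis.…` is the layout-mandated namespace (summit = problem name).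
set_option linter.dupNamespace false

namespace Summit.RiemannHypothesis.RiemannHypothesis.Theorems.WeilFormatC

open Literature.NumberTheory.LFunctions

namespace CinfR1E

/-- Packed rows part 1/1 of table `L2T` (word width 68, 4 words). -/
def L2T_P : List ℕ := [
  0x7f3d36c77ef8130d780381252e812de5e2808f452b395065e459f41d5f0308096676,
  0x843da8b934e30be5f80c7c2ee2a89ed6049b5be2a5853abc791809b26cb1dae53b2a,
  0x8201fa26d82ae794aa045f06bbca7caecf80bfef3c89a6985008061cc6e33db3e5a7,
  0x9d6cea47fc28387ff8223c0742d0b09d4784270d970123859b17fe5199d57e46b44e]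

end CinfR1E

end Summit.RiemannHypothesis.RiemannHypothesis.Theorems.WeilFormatC
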